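import Mathlib
import Summits.Ventures.PercRepro2.RowC1E1

/-!
# The `b`-avoiding sharpening (E1′) of row 2′C1, and (E1′) ⟹ (E1)
(blind cell PercRepro2, p2 g29; proofs/P2-G29-E1.md §2)

With `Q = {a₁ ↮ a₂}`, `C₁ = C(a₁)`, `C₂ = C(a₂)`, `U = C₁ ∪ C₂`, `μ = P(· | Q)`, write
`o ∈ U′` for «`o` is joined to `a₁` or to `a₂` by an open path that avoids the vertex `b`» and
`o ∈ K₁` for «`o` is joined to `a₁` avoiding `b`» (`avoidConnEvent`: connection in the configuration
with every edge at `b` closed, `delConfig ends {b}`).  The sharpening of record of this seat is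

  **(E1′)**  `μ(b ∈ C₂) · μ(o ∈ U′) ≤ μ(b ∈ C₂, o ∈ U′) + μ(b ∈ C₁, o ∈ K₁)`,

cleared by `P(Q)²` (`E1Avoid`).  It is stronger than (E1) (`RowC1.E1Cov`): `c1_of_e1avoid`
below is `E1Avoid ⟹ E1Cov` (hence ⟹ row 2′C1 by `c1_of_e1`).  The proof is the cut lemma
`conn_of_not_avoidConn` — an open path from `o` to a root that does not avoid `b` passes through
`b`, so the root is joined to `b` — which puts the «via `b`» part `{o ∈ U} ∖ {o ∈ U′}` of `{o ∈ U}`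
inside `{b ∈ C₂, o ∈ U} ∪ {b ∈ C₁, o ∈ C₁}` on `Q`; the rest is additivity and
`P(Q, b ∈ C₂) ≤ P(Q)`.  (E1′) is a CONJECTURE of the cell (exact census: 0 violations on 23,892
random instances n = 5, 6, extreme palettes, and on 1,221 instances with an extra avoided vertex;
proofs/P2-G29-E1.md), not a fact.
-/

namespace Summit.Ventures.PercRepro2

namespace RowC1

section Avoid

variable {V : Type*} {E : Type*} [Fintype E] [DecidableEq E]
  {R : Type*} [CommRing R] [LinearOrder R] [IsStrictOrderedRing R]

/-- `{x ↔ y avoiding b}`: `x` and `y` are joined by an open path in the configuration with every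
edge at `b` closed. -/
def avoidConnEvent (ends : E → Sym2 V) (b x y : V) : Set (Config E) :=
  {ω | Conn ends (delConfig ends {b} ω) x y}

omit [Fintype E] [DecidableEq E] in
/-- Closing the edges at `b` only closes edges. -/
lemma delConfig_singleton_le (ends : E → Sym2 V) (b : V) (ω : Config E) :
    delConfig ends {b} ω ≤ ω := by
  intro e
  by_cases h : e ∈ touches ends {b}
  · rw [delConfig_apply_of_mem h]; exact Bool.false_le _
  · rw [delConfig_apply_of_notMem h]

omit [Fintype E] [DecidableEq E] in
/-- A connection avoiding `b` is a connection. -/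
lemma conn_of_avoidConn {ends : E → Sym2 V} {b x y : V} {ω : Config E}
    (h : ω ∈ avoidConnEvent ends b x y) : Conn ends ω x y :=
  conn_mono (delConfig_singleton_le ends b ω) h

omit [Fintype E] [DecidableEq E] in
/-- **Cut lemma.** If `o ↔ r` but not avoiding `b`, then `b ↔ r` (the open path from `o` to `r`
passes through `b`). -/
lemma conn_of_not_avoidConn {ends : E → Sym2 V} {b o r : V} {ω : Config E}
    (h : Conn ends ω o r) (h' : ¬ Conn ends (delConfig ends {b} ω) o r) : Conn ends ω b r := by
  -- the set of vertices reached from `o` avoiding `b`, or reached from `b`, is closed under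
  -- open adjacency
  have key : r ∈ {x | Conn ends (delConfig ends {b} ω) o x ∨ Conn ends ω b x} := by
    refine mem_of_conn_of_closed (ends := ends) (ω := ω) ?_ (Or.inl (conn_refl _ _ _)) h
    rintro x (hx | hx) y hxy
    · obtain ⟨_, e, he, hends⟩ := openGraph_adj.1 hxy
      by_cases hb : e ∈ touches ends {b}
      · -- the edge is at `b`: one endpoint is `b`
        obtain ⟨z, hz, z', hzz'⟩ := hb
        rw [Set.mem_singleton_iff] at hz
        subst hz
        rw [hends] at hzz'
        rcases Sym2.eq_iff.1 hzz' with ⟨hxz, -⟩ | ⟨-, hyz⟩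
        · -- `x = b`: `y` is adjacent to `b`
          exact Or.inr (conn_of_openAdj ⟨e, he, by rw [hends, hxz]⟩)
        · -- `y = b`
          exact Or.inr (by rw [← hyz]; exact conn_refl _ _ _)
      · -- the edge is not at `b`: it is open in the avoiding configuration
        refine Or.inl (conn_trans hx (conn_of_openAdj ⟨e, ?_, hends⟩))
        rw [delConfig_apply_of_notMem hb]; exact he
    · obtain ⟨_, e, he, hends⟩ := openGraph_adj.1 hxy
      exact Or.inr (conn_trans hx (conn_of_openAdj ⟨e, he, hends⟩))
  rcases key with hk | hk
  · exact absurd hk h'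
  · exact hk

/-- **(E1′)**, cleared by `P(Q)²`:
`P(Q, b ∈ C₂) · P(Q, o ∈ U′) ≤ P(Q) · (P(Q, b ∈ C₂, o ∈ U′) + P(Q, b ∈ C₁, o ∈ K₁))`, where
`o ∈ U′` = `o` joined to `a₁` or `a₂` avoiding `b` and `o ∈ K₁` = `o` joined to `a₁` avoiding `b`.
A CONJECTURE (p2 g29; the sharpening of record of row 2′C1). -/
def E1Avoid (p : E → R) (ends : E → Sym2 V) (a₁ a₂ o b : V) : Prop :=
  prob p (connEvent ends a₂ b ∩ (connEvent ends a₁ a₂)ᶜ) *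
      prob p ((avoidConnEvent ends b a₁ o ∪ avoidConnEvent ends b a₂ o) ∩
        (connEvent ends a₁ a₂)ᶜ) ≤
    prob p (connEvent ends a₁ a₂)ᶜ *
      (prob p (connEvent ends a₂ b ∩ (avoidConnEvent ends b a₁ o ∪ avoidConnEvent ends b a₂ o) ∩
          (connEvent ends a₁ a₂)ᶜ) +
        prob p (connEvent ends a₁ b ∩ avoidConnEvent ends b a₁ o ∩ (connEvent ends a₁ a₂)ᶜ))

omit [Fintype E] [DecidableEq E] in
/-- The «via `b`» part of `{o ∈ U}` on `Q`: if `o ∈ U` but `o ∉ U′`, then either `b ∈ C₂` or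
(`b ∈ C₁` and `o ∈ C₁` not avoiding `b`). -/
lemma via_b_subset (ends : E → Sym2 V) (a₁ a₂ o b : V) :
    (connEvent ends a₁ o ∪ connEvent ends a₂ o) ∩
        (avoidConnEvent ends b a₁ o ∪ avoidConnEvent ends b a₂ o)ᶜ ∩ (connEvent ends a₁ a₂)ᶜ ⊆
      (connEvent ends a₂ b ∩ ((connEvent ends a₁ o ∪ connEvent ends a₂ o) ∩
          (avoidConnEvent ends b a₁ o ∪ avoidConnEvent ends b a₂ o)ᶜ) ∩ (connEvent ends a₁ a₂)ᶜ) ∪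
        (connEvent ends a₁ b ∩ connEvent ends a₁ o ∩ (avoidConnEvent ends b a₁ o)ᶜ ∩
          (connEvent ends a₁ a₂)ᶜ) := by
  rintro ω ⟨⟨hoU, hnot⟩, hQ⟩
  have hn1 : ¬ Conn ends (delConfig ends {b} ω) a₁ o := fun h => hnot (Or.inl h)
  have hn2 : ¬ Conn ends (delConfig ends {b} ω) a₂ o := fun h => hnot (Or.inr h)
  rcases hoU with ho1 | ho2
  · -- `o ↔ a₁`, not avoiding `b`: `b ↔ a₁`
    have hb : Conn ends ω b a₁ :=
      conn_of_not_avoidConn (conn_symm ho1) (fun h => hn1 (conn_symm h))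
    exact Or.inr ⟨⟨⟨conn_symm hb, ho1⟩, hn1⟩, hQ⟩
  · -- `o ↔ a₂`, not avoiding `b`: `b ↔ a₂`
    have hb : Conn ends ω b a₂ :=
      conn_of_not_avoidConn (conn_symm ho2) (fun h => hn2 (conn_symm h))
    exact Or.inl ⟨⟨conn_symm hb, ⟨Or.inr ho2, hnot⟩⟩, hQ⟩

/-- **(E1) from (E1′)**: `E1Avoid` gives `E1Cov`. -/
theorem e1_of_e1avoid (p : E → R) (hp : IsProbVec p) (ends : E → Sym2 V) (a₁ a₂ o b : V)
    (h : E1Avoid p ends a₁ a₂ o b) : E1Cov p ends a₁ a₂ o b := by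
  unfold E1Avoid at h
  unfold E1Cov
  -- names
  set Q := (connEvent ends a₁ a₂)ᶜ with hQdef
  set BH := connEvent ends a₂ b with hBH
  set BL := connEvent ends a₁ b with hBL
  set OU := connEvent ends a₁ o ∪ connEvent ends a₂ o with hOU
  set OU' := avoidConnEvent ends b a₁ o ∪ avoidConnEvent ends b a₂ o with hOU'
  set OK₁ := avoidConnEvent ends b a₁ o with hOK₁
  set OL := connEvent ends a₁ o with hOL
  -- `OU' ⊆ OU`
  have hsub : OU' ⊆ OU := by
    rintro ω (h1 | h2)
    · exact Or.inl (conn_of_avoidConn h1)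
    · exact Or.inr (conn_of_avoidConn h2)
  have hsub1 : OK₁ ⊆ OL := fun ω h1 => conn_of_avoidConn h1
  -- split `OU ∩ Q` and the two right-hand events
  have e1 : prob p (OU ∩ Q) = prob p (OU' ∩ Q) + prob p (OU ∩ OU'ᶜ ∩ Q) := by
    rw [← prob_union_of_disjoint p]
    · congr 1
      ext ω
      simp only [Set.mem_inter_iff, Set.mem_union, Set.mem_compl_iff]
      constructor
      · rintro ⟨hu, hq⟩
        by_cases hu' : ω ∈ OU'
        · exact Or.inl ⟨hu', hq⟩
        · exact Or.inr ⟨⟨hu, hu'⟩, hq⟩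
      · rintro (⟨hu', hq⟩ | ⟨⟨hu, -⟩, hq⟩)
        · exact ⟨hsub hu', hq⟩
        · exact ⟨hu, hq⟩
    · rw [Set.disjoint_left]
      rintro ω ⟨hu', -⟩ ⟨⟨-, hn⟩, -⟩
      exact hn hu'
  have e2 : prob p (BH ∩ OU ∩ Q) = prob p (BH ∩ OU' ∩ Q) + prob p (BH ∩ (OU ∩ OU'ᶜ) ∩ Q) := by
    rw [← prob_union_of_disjoint p]
    · congr 1
      ext ω
      simp only [Set.mem_inter_iff, Set.mem_union, Set.mem_compl_iff]
      constructor
      · rintro ⟨⟨hb, hu⟩, hq⟩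
        by_cases hu' : ω ∈ OU'
        · exact Or.inl ⟨⟨hb, hu'⟩, hq⟩
        · exact Or.inr ⟨⟨hb, hu, hu'⟩, hq⟩
      · rintro (⟨⟨hb, hu'⟩, hq⟩ | ⟨⟨hb, hu, -⟩, hq⟩)
        · exact ⟨⟨hb, hsub hu'⟩, hq⟩
        · exact ⟨⟨hb, hu⟩, hq⟩
    · rw [Set.disjoint_left]
      rintro ω ⟨⟨-, hu'⟩, -⟩ ⟨⟨-, -, hn⟩, -⟩
      exact hn hu'
  have e3 : prob p (BL ∩ OL ∩ Q) = prob p (BL ∩ OK₁ ∩ Q) + prob p (BL ∩ OL ∩ OK₁ᶜ ∩ Q) := by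
    rw [← prob_union_of_disjoint p]
    · congr 1
      ext ω
      simp only [Set.mem_inter_iff]
      constructor
      · rintro ⟨⟨hb, hl⟩, hq⟩
        by_cases hk : ω ∈ OK₁
        · exact Or.inl ⟨⟨hb, hk⟩, hq⟩
        · exact Or.inr ⟨⟨⟨hb, hl⟩, hk⟩, hq⟩
      · rintro (⟨⟨hb, hk⟩, hq⟩ | ⟨⟨⟨hb, hl⟩, -⟩, hq⟩)
        · exact ⟨⟨hb, hsub1 hk⟩, hq⟩
        · exact ⟨⟨hb, hl⟩, hq⟩
    · rw [Set.disjoint_left]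
      rintro ω ⟨⟨-, hk⟩, -⟩ ⟨⟨-, hn⟩, -⟩
      exact hn hk
  -- the «via `b`» part is covered by the two compensations
  have hvia : prob p (OU ∩ OU'ᶜ ∩ Q) ≤
      prob p (BH ∩ (OU ∩ OU'ᶜ) ∩ Q) + prob p (BL ∩ OL ∩ OK₁ᶜ ∩ Q) := by
    rw [← prob_union_of_disjoint p]
    · exact prob_mono hp (via_b_subset ends a₁ a₂ o b)
    · rw [Set.disjoint_left]
      rintro ω ⟨⟨hb2, -⟩, hQ⟩ ⟨⟨⟨hb1, -⟩, -⟩, -⟩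
      exact hQ (conn_trans hb1 (conn_symm hb2))
  have hxu : prob p (BH ∩ Q) ≤ prob p Q := prob_mono hp Set.inter_subset_right
  have h0v : 0 ≤ prob p (OU ∩ OU'ᶜ ∩ Q) := prob_nonneg hp _
  have h0Q : 0 ≤ prob p Q := prob_nonneg hp _
  rw [e1, e2, e3]
  nlinarith [h, hxu, hvia, h0v, h0Q, mul_le_mul_of_nonneg_right hxu h0v,
    mul_le_mul_of_nonneg_left hvia h0Q]

end Avoid

end RowC1

end Summit.Ventures.PercRepro2
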